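import Mathlib.Combinatorics.SetFamily.FourFunctions
import Literature.Combinatorics.SetFamily.AhlswedeDaykinDifferences
import HarnessLib

/-!
# Equality in Marica–Schönheim, II: pivots give products; the decreasing-coordinate lemma

Support file for the master-family `F`-inequality programme (`prim-master-conj` gen 29; `--supports stmt-CriticalPhenomena-4575`;
memo `run/shared/lean/prim/prim-l12/prim-master-conj/MS-EQUALITY.md` §1.2–§1.3).  No definition, no `sorry`, standard axioms.

A PIVOT of a family `F` is a member `h ∈ F` with `h ∪ f ∈ F` and `h ∩ f ∈ F` for every `f ∈ F`.  Write `F` TIGHT for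
`#(F \\ F) = #F` (equality in Marica–Schönheim).

§A (pivot + tight ⟹ product structure; memo §1.2).  If `F` is tight with pivot `h` then
* `union_sdiff_mem_of_pivot` — `(f ∩ h) ∪ (f' \ h) ∈ F` for all `f, f' ∈ F` (so `F ≅ {f ∩ h} × {f \ h}`);
* `exists_eq_union_of_mem_diffs_of_pivot` — every `e ∈ F \\ F` is `(h \ f) ∪ (f' \ h)` for some `f, f' ∈ F`;
* `mem_of_inter_mem_of_sdiff_mem` — membership test: `x ∩ h ∈ {f ∩ h}` and `x \ h ∈ {f \ h}` imply `x ∈ F`;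
* `inter_mem_image_of_mem_diffs`, `sdiff_mem_image_of_mem_diffs` — for `e ∈ F \\ F`: `h \ e ∈ {f ∩ h}` and `e \ h ∈ {f \ h}`;
* `mem_of_sdiff_mem_diffs` — if `h \ x ∈ F \\ F` and `x \ h ∈ F \\ F` then `x ∈ F` (the form used for (AMS-3), memo §2).
The proof of the first: `(h \ f) ∪ (f' \ h) = (h ∪ f') \ (h ∩ f) ∈ F \\ F`, the maps `f ↦ (h \ f, f \ h)` and `(x, y) ↦ x ∪ y`
are injective, so `#F ≤ #{h \ f}·#{f \ h} ≤ #(F \\ F) = #F` and the first map is onto the product.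

§B (LEMMA α, memo §1.3 Step 2).  `exists_core_of_sections`: let `P, Q` be finite families (think `P = F.memberSubfamily r`,
`Q = F.nonMemberSubfamily r`) with `Q` tight with a pivot `h`, `P` nonempty, `P \\ P ⊆ Q \\ Q`, `Q \\ P ⊆ Q \\ Q` and
`#(P \\ Q) = #P`.  Then there is a set `c`, disjoint from every member of `Q` and contained in every member of `P`, with
`p \ c ∈ Q` for all `p ∈ P`.  (Proof: with `U = {q ∩ h}`, `W = {q \ h}`, `T₂ = ⋃ W`: every `p` has `p ∩ h ∈ U`, all `p` agree
outside `h ∪ T₂` (call the common trace `c`), the Ahlswede–Daykin difference theorem (tree: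
`Literature.Combinatorics.SetFamily.card_le_card_diffs_of_forall_exists_subset`) applied to `P` and `{p ∩ h}` shows that the traces
`p ∩ T₂` are closed under removing members of `W`, hence some `p° ∈ P` has empty trace, and then `p \ p° ∈ Q \\ Q` forces every
trace `p ∩ T₂` into `W`.)

HONEST FRAMING: steps of a proof of the equality case of Marica–Schönheim that we could not find in print; [this work].
-/

namespace Summit.CriticalPhenomena.PercolationContinuityZ3.Theorems

namespace TwistedAD

open Finset
open scoped FinsetFamily

variable {α : Type*} [DecidableEq α]

/-! ### §A  Pivot + tight ⟹ product -/

/-- For a pivot `h` of `F`: `(h \ f) ∪ (f' \ h) = (h ∪ f') \ (h ∩ f) ∈ F \\ F` for all `f, f' ∈ F`. [this work] -/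
theorem sdiff_union_sdiff_mem_diffs_of_pivot (F : Finset (Finset α)) (h : Finset α)
    (hpiv : ∀ f ∈ F, h ∪ f ∈ F ∧ h ∩ f ∈ F) {f f' : Finset α} (hf : f ∈ F) (hf' : f' ∈ F) :
    (h \ f) ∪ (f' \ h) ∈ F \\ F := by
  rw [mem_diffs]
  refine ⟨h ∪ f', (hpiv f' hf').1, h ∩ f, (hpiv f hf).2, ?_⟩
  ext x
  simp only [mem_sdiff, mem_union, mem_inter]
  tauto

/-- A set is recovered from its traces inside and outside `h`: if `g ∩ h = g' ∩ h` and `g \ h = g' \ h` then `g = g'`.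
[this work] -/
theorem eq_of_inter_eq_of_sdiff_eq {g g' h : Finset α} (h1 : g ∩ h = g' ∩ h) (h2 : g \ h = g' \ h) : g = g' := by
  rw [← sdiff_union_inter g h, h1, h2, sdiff_union_inter]

/-- `h \ (h \ g) = g ∩ h`. [this work] -/
theorem sdiff_sdiff_self_eq_inter (g h : Finset α) : h \ (h \ g) = g ∩ h := by
  rw [sdiff_sdiff_self_left, inter_comm]

/-- `(g ∩ h) ∪ (g \ h) = g`. [this work] -/
theorem inter_union_sdiff_self (g h : Finset α) : (g ∩ h) ∪ (g \ h) = g := by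
  rw [union_comm, sdiff_union_inter]

/-- If `x ⊆ h` and `y` is disjoint from `h` then `(x ∪ y) ∩ h = x`. [this work] -/
theorem union_inter_eq_left_of {x y h : Finset α} (hx : x ⊆ h) (hy : Disjoint y h) : (x ∪ y) ∩ h = x := by
  ext a
  simp only [mem_inter, mem_union]
  constructor
  · rintro ⟨hxy, hah⟩
    rcases hxy with hax | hay
    · exact hax
    · exact absurd hah (disjoint_left.1 hy hay)
  · intro hax
    exact ⟨Or.inl hax, hx hax⟩

/-- If `x ⊆ h` and `y` is disjoint from `h` then `(x ∪ y) \ h = y`. [this work] -/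
theorem union_sdiff_eq_right_of {x y h : Finset α} (hx : x ⊆ h) (hy : Disjoint y h) : (x ∪ y) \ h = y := by
  ext a
  simp only [mem_sdiff, mem_union]
  constructor
  · rintro ⟨hxy, hah⟩
    rcases hxy with hax | hay
    · exact absurd (hx hax) hah
    · exact hay
  · intro hay
    exact ⟨Or.inr hay, disjoint_left.1 hy hay⟩

/-- **Pivot + tight ⟹ product.**  If `#(F \\ F) = #F` and `h` is a pivot of `F`, then `(f ∩ h) ∪ (f' \ h) ∈ F` for all
`f, f' ∈ F`. [this work] -/
theorem union_sdiff_mem_of_pivot (F : Finset (Finset α)) (htight : #(F \\ F) = #F) (h : Finset α)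
    (hpiv : ∀ f ∈ F, h ∪ f ∈ F ∧ h ∩ f ∈ F) {f f' : Finset α} (hf : f ∈ F) (hf' : f' ∈ F) :
    (f ∩ h) ∪ (f' \ h) ∈ F := by
  set R := F.image (fun g => h \ g) with hR
  set C := F.image (fun g => g \ h) with hC
  -- the union map `R ×ˢ C → F \\ F` is injective, so `#(R ×ˢ C) ≤ #(F \\ F) = #F`
  have hRC : #(R ×ˢ C) ≤ #F := by
    rw [← htight]
    refine card_le_card_of_injOn (fun xy => xy.1 ∪ xy.2) ?_ ?_
    · intro xy hxy
      rw [mem_coe, mem_product, hR, hC, mem_image, mem_image] at hxy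
      obtain ⟨⟨g, hg, hgx⟩, ⟨g', hg', hg'y⟩⟩ := hxy
      show xy.1 ∪ xy.2 ∈ ((F \\ F : Finset (Finset α)) : Set (Finset α))
      rw [mem_coe, ← hgx, ← hg'y]
      exact sdiff_union_sdiff_mem_diffs_of_pivot F h hpiv hg hg'
    · intro xy hxy xy' hxy' heq
      rw [mem_coe, mem_product, hR, hC, mem_image, mem_image] at hxy hxy'
      obtain ⟨⟨g, -, hgx⟩, ⟨g', -, hg'y⟩⟩ := hxy
      obtain ⟨⟨k, -, hkx⟩, ⟨k', -, hk'y⟩⟩ := hxy'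
      have h1 : xy.1 ⊆ h := by rw [← hgx]; exact sdiff_subset
      have h1' : xy'.1 ⊆ h := by rw [← hkx]; exact sdiff_subset
      have h2 : Disjoint xy.2 h := by rw [← hg'y]; exact sdiff_disjoint
      have h2' : Disjoint xy'.2 h := by rw [← hk'y]; exact sdiff_disjoint
      have heq' : xy.1 ∪ xy.2 = xy'.1 ∪ xy'.2 := heq
      have e1 : xy.1 = xy'.1 := by
        have : (xy.1 ∪ xy.2) ∩ h = (xy'.1 ∪ xy'.2) ∩ h := by rw [heq']
        rwa [union_inter_eq_left_of h1 h2, union_inter_eq_left_of h1' h2'] at this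
      have e2 : xy.2 = xy'.2 := by
        have : (xy.1 ∪ xy.2) \ h = (xy'.1 ∪ xy'.2) \ h := by rw [heq']
        rwa [union_sdiff_eq_right_of h1 h2, union_sdiff_eq_right_of h1' h2'] at this
      exact Prod.ext e1 e2
  -- the map `g ↦ (h \ g, g \ h)` is injective into `R ×ˢ C`, hence onto (cardinalities)
  have hmaps : ∀ g (hg : g ∈ F), (fun g (_ : g ∈ F) => (h \ g, g \ h)) g hg ∈ R ×ˢ C := fun g hg =>
    mem_product.2 ⟨mem_image_of_mem _ hg, mem_image_of_mem _ hg⟩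
  have hinj : ∀ g g' (hg : g ∈ F) (hg' : g' ∈ F),
      (fun g (_ : g ∈ F) => (h \ g, g \ h)) g hg = (fun g (_ : g ∈ F) => (h \ g, g \ h)) g' hg' → g = g' := by
    intro g g' _ _ hgg
    obtain ⟨e1, e2⟩ := Prod.mk.inj hgg
    refine eq_of_inter_eq_of_sdiff_eq ?_ e2
    rw [← sdiff_sdiff_self_eq_inter g h, ← sdiff_sdiff_self_eq_inter g' h, e1]
  obtain ⟨g, hg, hgeq⟩ := surj_on_of_inj_on_of_card_le (s := F) (t := R ×ˢ C)
    (fun g (_ : g ∈ F) => (h \ g, g \ h)) hmaps hinj hRC (h \ f, f' \ h)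
    (mem_product.2 ⟨mem_image_of_mem _ hf, mem_image_of_mem _ hf'⟩)
  -- `g = (f ∩ h) ∪ (f' \ h)`
  obtain ⟨e1, e2⟩ := Prod.mk.inj hgeq
  have e3 : g ∩ h = f ∩ h := by rw [← sdiff_sdiff_self_eq_inter g h, ← sdiff_sdiff_self_eq_inter f h, ← e1]
  have : g = (f ∩ h) ∪ (f' \ h) := by rw [← e3, e2]; exact (inter_union_sdiff_self g h).symm
  rw [← this]
  exact hg

/-- If `F` is tight with pivot `h`, every difference `e ∈ F \\ F` is `(h \ f) ∪ (f' \ h)` for some `f, f' ∈ F`; in particular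
`h \ e = f ∩ h` and `e \ h = f' \ h`. [this work] -/
theorem exists_eq_union_of_mem_diffs_of_pivot (F : Finset (Finset α)) (htight : #(F \\ F) = #F) (h : Finset α)
    (hpiv : ∀ f ∈ F, h ∪ f ∈ F ∧ h ∩ f ∈ F) {e : Finset α} (he : e ∈ F \\ F) :
    ∃ f ∈ F, ∃ f' ∈ F, e = (h \ f) ∪ (f' \ h) := by
  -- the image of `(f, f') ↦ (h \ f) ∪ (f' \ h)` has `#F`... more precisely: `R ∨ C ⊆ F \\ F` and `#(R ∨ C) ≥ #F = #(F \\ F)`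
  set R := F.image (fun g => h \ g) with hR
  set C := F.image (fun g => g \ h) with hC
  set S := (R ×ˢ C).image (fun xy => xy.1 ∪ xy.2) with hS
  have hSsub : S ⊆ F \\ F := by
    intro e' he'
    rw [hS, mem_image] at he'
    obtain ⟨xy, hxy, rfl⟩ := he'
    rw [mem_product, hR, hC, mem_image, mem_image] at hxy
    obtain ⟨⟨g, hg, hgx⟩, ⟨g', hg', hg'y⟩⟩ := hxy
    rw [← hgx, ← hg'y]
    exact sdiff_union_sdiff_mem_diffs_of_pivot F h hpiv hg hg'
  -- `#F ≤ #S`: the map `g ↦ (h \ g) ∪ (g \ h)` is injective into `S`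
  have hFS : #F ≤ #S := by
    refine card_le_card_of_injOn (fun g => (h \ g) ∪ (g \ h)) ?_ ?_
    · intro g hg
      rw [mem_coe] at hg
      show (h \ g) ∪ (g \ h) ∈ ((S : Finset (Finset α)) : Set (Finset α))
      rw [mem_coe, hS, mem_image]
      exact ⟨(h \ g, g \ h), mem_product.2 ⟨mem_image_of_mem _ hg, mem_image_of_mem _ hg⟩, rfl⟩
    · intro g _ g' _ hgg
      have hgg' : (h \ g) ∪ (g \ h) = (h \ g') ∪ (g' \ h) := hgg
      have e2 : g \ h = g' \ h := by
        have : ((h \ g) ∪ (g \ h)) \ h = ((h \ g') ∪ (g' \ h)) \ h := by rw [hgg']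
        rwa [union_sdiff_eq_right_of sdiff_subset (Finset.sdiff_disjoint),
          union_sdiff_eq_right_of sdiff_subset (Finset.sdiff_disjoint)] at this
      have e1 : h \ g = h \ g' := by
        have : ((h \ g) ∪ (g \ h)) ∩ h = ((h \ g') ∪ (g' \ h)) ∩ h := by rw [hgg']
        rwa [union_inter_eq_left_of sdiff_subset (Finset.sdiff_disjoint),
          union_inter_eq_left_of sdiff_subset (Finset.sdiff_disjoint)] at this
      refine eq_of_inter_eq_of_sdiff_eq ?_ e2
      rw [← sdiff_sdiff_self_eq_inter g h, ← sdiff_sdiff_self_eq_inter g' h, e1]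
  have hSeq : S = F \\ F := eq_of_subset_of_card_le hSsub (by rw [htight]; exact hFS)
  have he' : e ∈ S := by rw [hSeq]; exact he
  rw [hS, mem_image] at he'
  obtain ⟨xy, hxy, rfl⟩ := he'
  rw [mem_product, hR, hC, mem_image, mem_image] at hxy
  obtain ⟨⟨g, hg, hgx⟩, ⟨g', hg', hg'y⟩⟩ := hxy
  exact ⟨g, hg, g', hg', by rw [hgx, hg'y]⟩

/-- Membership test (tight `F`, pivot `h`): if `x ∩ h = f ∩ h` and `x \ h = f' \ h` for some `f, f' ∈ F` then `x ∈ F`.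
[this work] -/
theorem mem_of_inter_mem_of_sdiff_mem (F : Finset (Finset α)) (htight : #(F \\ F) = #F) (h : Finset α)
    (hpiv : ∀ f ∈ F, h ∪ f ∈ F ∧ h ∩ f ∈ F) {x : Finset α}
    (hx1 : x ∩ h ∈ F.image (fun g => g ∩ h)) (hx2 : x \ h ∈ F.image (fun g => g \ h)) : x ∈ F := by
  rw [mem_image] at hx1 hx2
  obtain ⟨f, hf, hfx⟩ := hx1
  obtain ⟨f', hf', hf'x⟩ := hx2
  have : x = (f ∩ h) ∪ (f' \ h) := by rw [hfx, hf'x]; exact (inter_union_sdiff_self x h).symm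
  rw [this]
  exact union_sdiff_mem_of_pivot F htight h hpiv hf hf'

/-- For tight `F` with pivot `h` and `e ∈ F \\ F`: `h \ e ∈ {f ∩ h : f ∈ F}`. [this work] -/
theorem inter_mem_image_of_mem_diffs (F : Finset (Finset α)) (htight : #(F \\ F) = #F) (h : Finset α)
    (hpiv : ∀ f ∈ F, h ∪ f ∈ F ∧ h ∩ f ∈ F) {e : Finset α} (he : e ∈ F \\ F) :
    h \ e ∈ F.image (fun g => g ∩ h) := by
  obtain ⟨f, hf, f', -, rfl⟩ := exists_eq_union_of_mem_diffs_of_pivot F htight h hpiv he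
  rw [mem_image]
  refine ⟨f, hf, ?_⟩
  -- `h \ ((h \ f) ∪ (f' \ h)) = h \ (h \ f) = f ∩ h`
  ext x
  simp only [mem_sdiff, mem_union, mem_inter]
  tauto

/-- For tight `F` with pivot `h` and `e ∈ F \\ F`: `e \ h ∈ {f \ h : f ∈ F}`. [this work] -/
theorem sdiff_mem_image_of_mem_diffs (F : Finset (Finset α)) (htight : #(F \\ F) = #F) (h : Finset α)
    (hpiv : ∀ f ∈ F, h ∪ f ∈ F ∧ h ∩ f ∈ F) {e : Finset α} (he : e ∈ F \\ F) :
    e \ h ∈ F.image (fun g => g \ h) := by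
  obtain ⟨f, -, f', hf', rfl⟩ := exists_eq_union_of_mem_diffs_of_pivot F htight h hpiv he
  rw [mem_image]
  refine ⟨f', hf', ?_⟩
  -- `((h \ f) ∪ (f' \ h)) \ h = f' \ h`
  ext x
  simp only [mem_sdiff, mem_union]
  tauto

/-- **The (AMS-3) test.**  If `F` is tight with pivot `h` and both `h \ x` and `x \ h` are differences of `F`, then `x ∈ F`.
(Memo §2: this is why a tight class cannot absorb a new antipodal pair.) [this work] -/
theorem mem_of_sdiff_mem_diffs (F : Finset (Finset α)) (htight : #(F \\ F) = #F) (h : Finset α)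
    (hpiv : ∀ f ∈ F, h ∪ f ∈ F ∧ h ∩ f ∈ F) {x : Finset α}
    (hx1 : h \ x ∈ F \\ F) (hx2 : x \ h ∈ F \\ F) : x ∈ F := by
  refine mem_of_inter_mem_of_sdiff_mem F htight h hpiv ?_ ?_
  · have := inter_mem_image_of_mem_diffs F htight h hpiv hx1
    rwa [sdiff_sdiff_self_eq_inter] at this
  · have := sdiff_mem_image_of_mem_diffs F htight h hpiv hx2
    rwa [Finset.sdiff_idem] at this

/-! ### §B  LEMMA α: the member-section is a core-translate of a subfamily of the non-member section -/

/-- **Lemma α** (memo §1.3 Step 2).  Let `Q` be tight with pivot `h`, `P` nonempty with `P \\ P ⊆ Q \\ Q`, `Q \\ P ⊆ Q \\ Q`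
and `#(P \\ Q) = #P`.  Then some set `c`, disjoint from every member of `Q` and contained in every member of `P`, satisfies
`p \ c ∈ Q` for all `p ∈ P`.  (Applied with `P = F.memberSubfamily r`, `Q = F.nonMemberSubfamily r` after `tight_section_of_card_le`:
the coordinate `r` is then "decreasing" — every member containing `r` contains the block `insert r c` and stays in `F` when the
block is removed.) [this work] -/
theorem exists_core_of_sections (P Q : Finset (Finset α)) (hQtight : #(Q \\ Q) = #Q) (h : Finset α) (hhQ : h ∈ Q)
    (hpiv : ∀ q ∈ Q, h ∪ q ∈ Q ∧ h ∩ q ∈ Q) (hPne : P.Nonempty)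
    (hPP : P \\ P ⊆ Q \\ Q) (hQP : Q \\ P ⊆ Q \\ Q) (hcard : #(P \\ Q) = #P) :
    ∃ c : Finset α, (∀ q ∈ Q, Disjoint c q) ∧ ∀ p ∈ P, c ⊆ p ∧ p \ c ∈ Q := by
  set U := Q.image (fun g => g ∩ h) with hU
  set W := Q.image (fun g => g \ h) with hW
  set T₂ := W.biUnion id with hT₂
  -- basic facts about `W` and `T₂`
  have hWsub : ∀ w ∈ W, w ⊆ T₂ := fun w hw => subset_biUnion_of_mem id hw
  have hT₂h : ∀ x ∈ T₂, x ∉ h := by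
    intro x hx
    rw [hT₂, mem_biUnion] at hx
    obtain ⟨w, hw, hxw⟩ := hx
    rw [hW, mem_image] at hw
    obtain ⟨q, -, rfl⟩ := hw
    exact (mem_sdiff.1 hxw).2
  have hqsub : ∀ q ∈ Q, ∀ x ∈ q, x ∉ h → x ∈ T₂ := fun q hq x hxq hxh =>
    hWsub _ (mem_image_of_mem _ hq) (mem_sdiff.2 ⟨hxq, hxh⟩)
  have hemptyW : (∅ : Finset α) ∈ W := by
    rw [hW, mem_image]; exact ⟨h, hhQ, by simp⟩
  -- (a) `p ∩ h ∈ U` for `p ∈ P`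
  have hp1 : ∀ p ∈ P, p ∩ h ∈ U := by
    intro p hp
    have : h \ p ∈ Q \\ Q := hQP (mem_diffs.2 ⟨h, hhQ, p, hp, rfl⟩)
    have := inter_mem_image_of_mem_diffs Q hQtight h hpiv this
    rwa [sdiff_sdiff_self_eq_inter] at this
  -- (b) differences of members of `P` avoid everything outside `h ∪ T₂`
  have hb : ∀ p ∈ P, ∀ p' ∈ P, ∀ x ∈ p, x ∉ p' → x ∉ h → x ∈ T₂ := by
    intro p hp p' hp' x hxp hxp' hxh
    have hmem : (p \ p') \ h ∈ W := sdiff_mem_image_of_mem_diffs Q hQtight h hpiv (hPP (mem_diffs.2 ⟨p, hp, p', hp', rfl⟩))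
    exact hWsub _ hmem (mem_sdiff.2 ⟨mem_sdiff.2 ⟨hxp, hxp'⟩, hxh⟩)
  -- the common core `c`
  obtain ⟨p₀, hp₀⟩ := hPne
  set c := (p₀ \ h) \ T₂ with hc
  have hcmem : ∀ p ∈ P, ∀ x, x ∈ c ↔ x ∈ p ∧ x ∉ h ∧ x ∉ T₂ := by
    intro p hp x
    rw [hc, mem_sdiff, mem_sdiff]
    constructor
    · rintro ⟨⟨hx0, hxh⟩, hxT⟩
      refine ⟨?_, hxh, hxT⟩
      by_contra hxp
      exact hxT (hb p₀ hp₀ p hp x hx0 hxp hxh)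
    · rintro ⟨hxp, hxh, hxT⟩
      refine ⟨⟨?_, hxh⟩, hxT⟩
      by_contra hx0
      exact hxT (hb p hp p₀ hp₀ x hxp hx0 hxh)
  have hcQ : ∀ q ∈ Q, Disjoint c q := by
    intro q hq
    rw [disjoint_left]
    intro x hxc hxq
    obtain ⟨-, hxh, hxT⟩ := (hcmem p₀ hp₀ x).1 hxc
    exact hxT (hqsub q hq x hxq hxh)
  have hcP : ∀ p ∈ P, c ⊆ p := fun p hp x hx => ((hcmem p hp x).1 hx).1
  -- (c) Ahlswede–Daykin: `P \\ U' = P \\ Q` with `U' = {p ∩ h}` ⊆ `Q`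
  set U' := P.image (fun g => g ∩ h) with hU'
  have hU'Q : U' ⊆ Q := by
    intro u hu
    rw [hU', mem_image] at hu
    obtain ⟨p, hp, rfl⟩ := hu
    refine mem_of_inter_mem_of_sdiff_mem Q hQtight h hpiv ?_ ?_
    · rw [inter_assoc, inter_self]; exact hp1 p hp
    · rw [mem_image]
      refine ⟨h, hhQ, ?_⟩
      rw [Finset.sdiff_self, eq_comm, sdiff_eq_empty_iff_subset]
      exact inter_subset_right
  have hAD : #P ≤ #(P \\ U') :=
    Literature.Combinatorics.SetFamily.card_le_card_diffs_of_forall_exists_subset P U'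
      (fun p hp => ⟨p ∩ h, mem_image_of_mem _ hp, inter_subset_left⟩)
  have hPU' : P \\ U' = P \\ Q :=
    eq_of_subset_of_card_le (diffs_subset_left hU'Q) (by rw [hcard]; exact hAD)
  -- closure of the traces `p ∩ T₂` under removing members of `W`
  set Tr := P.image (fun g => g ∩ T₂) with hTr
  have hclosed : ∀ p ∈ P, ∀ w ∈ W, (p ∩ T₂) \ w ∈ Tr := by
    intro p hp w hw
    rw [hW, mem_image] at hw
    obtain ⟨q, hq, rfl⟩ := hw
    have hpq : p \ q ∈ P \\ U' := by rw [hPU']; exact mem_diffs.2 ⟨p, hp, q, hq, rfl⟩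
    rw [mem_diffs] at hpq
    obtain ⟨p', hp', u, hu, hequ⟩ := hpq
    rw [hU', mem_image] at hu
    obtain ⟨p'', hp'', rfl⟩ := hu
    rw [hTr, mem_image]
    refine ⟨p', hp', ?_⟩
    -- compare the `T₂`-traces of `p' \ (p'' ∩ h) = p \ q`
    ext x
    simp only [mem_inter, mem_sdiff]
    constructor
    · rintro ⟨hxp', hxT⟩
      have hxh : x ∉ h := hT₂h x hxT
      have : x ∈ p' \ (p'' ∩ h) := mem_sdiff.2 ⟨hxp', fun hx => hxh (mem_inter.1 hx).2⟩
      rw [hequ, mem_sdiff] at this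
      exact ⟨⟨this.1, hxT⟩, fun hx => this.2 hx.1⟩
    · rintro ⟨⟨hxp, hxT⟩, hxq⟩
      have hxh : x ∉ h := hT₂h x hxT
      have : x ∈ p \ q := mem_sdiff.2 ⟨hxp, fun hx => hxq ⟨hx, hxh⟩⟩
      rw [← hequ, mem_sdiff] at this
      exact ⟨this.1, hxT⟩
  -- (d) some member of `P` has empty `T₂`-trace
  have hTrne : Tr.Nonempty := ⟨p₀ ∩ T₂, mem_image_of_mem _ hp₀⟩
  obtain ⟨t, ht, htmin⟩ := exists_min_image Tr (fun s => #s) hTrne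
  have ht0 : t = ∅ := by
    by_contra hne
    obtain ⟨x, hxt⟩ := nonempty_iff_ne_empty.2 hne
    rw [hTr, mem_image] at ht
    obtain ⟨p, hp, rfl⟩ := ht
    have hxT : x ∈ T₂ := (mem_inter.1 hxt).2
    rw [hT₂, mem_biUnion] at hxT
    obtain ⟨w, hw, hxw⟩ := hxT
    have hmem : (p ∩ T₂) \ w ∈ Tr := hclosed p hp w hw
    have hlt : #((p ∩ T₂) \ w) < #(p ∩ T₂) :=
      card_lt_card ⟨sdiff_subset, fun hsub => (mem_sdiff.1 (hsub hxt)).2 hxw⟩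
    exact absurd (htmin _ hmem) (not_le.2 hlt)
  rw [ht0, hTr, mem_image] at ht
  obtain ⟨p₁, hp₁, hp₁T⟩ := ht
  -- (e) every trace `p ∩ T₂` lies in `W`, and `p \ c ∈ Q`
  refine ⟨c, hcQ, fun p hp => ⟨hcP p hp, ?_⟩⟩
  have htrace : (p \ p₁) \ h = p ∩ T₂ := by
    ext x
    simp only [mem_sdiff, mem_inter]
    constructor
    · rintro ⟨⟨hxp, hxp₁⟩, hxh⟩
      exact ⟨hxp, hb p hp p₁ hp₁ x hxp hxp₁ hxh⟩
    · rintro ⟨hxp, hxT⟩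
      refine ⟨⟨hxp, fun hx1 => ?_⟩, hT₂h x hxT⟩
      have : x ∈ p₁ ∩ T₂ := mem_inter.2 ⟨hx1, hxT⟩
      rw [hp₁T] at this
      exact notMem_empty x this
  have hpTW : p ∩ T₂ ∈ W := by
    rw [← htrace]
    exact sdiff_mem_image_of_mem_diffs Q hQtight h hpiv (hPP (mem_diffs.2 ⟨p, hp, p₁, hp₁, rfl⟩))
  refine mem_of_inter_mem_of_sdiff_mem Q hQtight h hpiv ?_ ?_
  · -- `(p \ c) ∩ h = p ∩ h`
    have : (p \ c) ∩ h = p ∩ h := by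
      ext x
      simp only [mem_inter, mem_sdiff]
      constructor
      · rintro ⟨⟨hxp, -⟩, hxh⟩; exact ⟨hxp, hxh⟩
      · rintro ⟨hxp, hxh⟩; exact ⟨⟨hxp, fun hxc => ((hcmem p hp x).1 hxc).2.1 hxh⟩, hxh⟩
    rw [this]; exact hp1 p hp
  · -- `(p \ c) \ h = p ∩ T₂`
    have : (p \ c) \ h = p ∩ T₂ := by
      ext x
      simp only [mem_inter, mem_sdiff]
      constructor
      · rintro ⟨⟨hxp, hxc⟩, hxh⟩
        refine ⟨hxp, ?_⟩
        by_contra hxT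
        exact hxc ((hcmem p hp x).2 ⟨hxp, hxh, hxT⟩)
      · rintro ⟨hxp, hxT⟩
        exact ⟨⟨hxp, fun hxc => ((hcmem p hp x).1 hxc).2.2 hxT⟩, hT₂h x hxT⟩
    rw [this]; exact hpTW

end TwistedAD

end Summit.CriticalPhenomena.PercolationContinuityZ3.Theorems
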